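/-
Copyright (c) 2026 the pub-hodgecm-mathlib formalisation cell (harness21).  Prover seat hodgecm-mathlib-K2E3-p21 (g5), Track B «K2-LIT» ∕ h413
(`stmt-HodgeConjecture-24833`), line `K2_E3_EllipticInputs`, unit U12 §L, road «GL-[M6]-sc» (line lead K2E3-p23 (g5), RULINGS #11 (M11-3): T20-GL₃ co-owned with
K2E5-p17 (g4); contract 2026-09-04T07:09:09Z), brick T20-GL₃ (B-Iw), FILE 2: «IWAHORI ORDERS OF `K_γ ≤ GL_n(F)` FOR EVERY STANDARD PARABOLIC `P_c`, `c : Fin n → Fin r`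
(Borel included), AT EVERY LEVEL `γ < 1`, IN ★ (A)'s `hIw` SHAPE».  2026-09-04.
-/
import Summits.HodgeConjecture.HodgeConjecture.Theorems.K2E3GLnCongruenceIwahoriTriple   -- ★ (B-Iw) FILE 1 p858151 (this seat): `iwahori_map_conj`, `conj_mem_congruenceGL_of_mem_glInt`
import Literature.NumberTheory.Automorphic.ParabolicGLBigCell                          -- ★ `exists_parabolic_mul_lower_of_mem_congruenceGL` (`K_γ = (K_γ ∩ P_c)(K_γ ∩ U_{c⁻})`, any labels, any `γ < 1`)
import Summits.HodgeConjecture.HodgeConjecture.Theorems.F0P3cStCharTSShellKN           -- ★ `coe_eq_mul_mul_symm` (reversal of a set-theoretic triple factorisation by inversion)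
import HarnessLib

/-!
# K2_E3 road (h413), Theorem 20 for `GL₃` (T20-GL₃), input file (B-Iw) 2: `K_γ = (K_γ ∩ U_c⁻)(K_γ ∩ M_c)(K_γ ∩ U_c)` for every standard parabolic of `GL_n(F)`

Cell `pub/hodgecm-mathlib` (D-0151), Track B, seat K2E3-p21 (g5); T20-GL₃ co-owner K2E5-p17 (g4) (consumer ★ (A) `K2E3CuspFormCancellationPolychotomy`, binder
`hIw : ∀ k ∈ K₀, ∃ v ∈ K₀ ⊓ V, ∃ t ∈ K₀ ⊓ T, ∃ u ∈ K₀ ⊓ U, k = v * t * u`; contract 07:09:09Z: `K₀ = congruenceGL 3 (valuation F ϖ ^ m)`, Borel = labels `id : Fin 3 → Fin 3`,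
`toDual ∘ id`, `standardLeviGL F id`; maximal parabolics = `![0,0,1]`, `![0,1,1]`).  `--supports stmt-HodgeConjecture-24833 --as helper`; THEOREMS ONLY.

THE MATHEMATICS [Casselman1995, Prop. 1.4.4]; [BernsteinZelevinsky1976, §3.13]; [HarishChandra1970, Part VII §8 p. 81].  ★ `exists_parabolic_mul_lower_of_mem_congruenceGL` gives
`K_γ = (K_γ ∩ P_c)(K_γ ∩ U_{c⁻})` for EVERY labelling `c : Fin n → α` and every `γ < 1`; the LEVI SPLITTING `K_γ ∩ P_c = (K_γ ∩ M_c)(K_γ ∩ U_c)` (the block-diagonal part of a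
`γ`-congruent matrix is `γ`-congruent and invertible, ★ `isUnit_det_and_valBound_inv` — ★ FILE 1's argument for any finite label order) then yields both three-factor orders for
the Borel (`c = id : Fin n → Fin n`) and ALL standard parabolics at once, in any label type (`Fin r`, `Bool`, …).  (★ `iwahoriDatumGL….factorization` records the set form at the
levels `|ϖ|^{j+1}` for monotone `Fin r`-labels; ★ FILE 1 did two-block `Fin 2`-labels, incl. non-monotone ones.)
* §1 GENERIC set-form bookkeeping: `forall_exists_mul_of_coe_eq_mul` (a set-theoretic triple factorisation `↑K₀ = ↑(K₀ ⊓ V)·↑(K₀ ⊓ T)·↑(K₀ ⊓ U)` IS the `hIw` binder —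
  unpacks ★ `.factorization j` and §2), `coe_eq_mul_of_forall_exists_mul` (packing), `coe_eq_mul_map_conj` (conjugate triples); reversal by inversion is ★ `F0P3cStCharTSShellKN.coe_eq_mul_mul_symm`.
* §2 `exists_levi_mul_radical_of_mem_congruenceGL` (`p ∈ P_c ∩ K_γ ⇒ p = t u`) and the SET FORMS **`coe_congruenceGL_eq_mul_iwahori'`** (`u t v`), **`coe_congruenceGL_eq_mul_iwahori`**
  (`v t u`), **`coe_congruenceGL_eq_mul_iwahori_map_conj`** ∕ `…'` (conjugates by `w ∈ GL_n(𝒪)`) — for every labelling `c : Fin n → α`, every `γ < 1`; `hIw` = §1 ∘ §2 (one line).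
  (The `∃`-shaped two-block `Fin 2` statements are ★ FILE 1.)

HONEST LABEL: HC_CM is proved only modulo the 7 printed citations (2 remaining named inputs: hLiu418 = `stmt-HodgeConjecture-24832`, h413 = `stmt-HodgeConjecture-24833`)
until rung 0 closes; this file is a count-neutral helper and closes no socket.

## References
* [Casselman1995] W. Casselman, *Introduction to the theory of admissible representations of `p`-adic reductive groups* (1995 notes), Prop. 1.4.4.
* [BernsteinZelevinsky1976] I. N. Bernstein, A. V. Zelevinsky, *Representations of the group GL(n, F) where F is a non-archimedean local field*, Russian Math.
  Surveys 31:3 (1976), §3.13.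
* [HarishChandra1970] Harish-Chandra (notes by G. van Dijk), *Harmonic Analysis on Reductive p-adic Groups*, LNM 162 (1970), Part VII §8 p. 81.
-/

set_option autoImplicit false
-- the mandated namespace repeats the single-problem summit's segment (`HodgeConjecture.HodgeConjecture`)
set_option linter.dupNamespace false

open scoped MatrixGroups Pointwise
open ValuativeRel Matrix
open Literature.NumberTheory.Automorphic
open Summit.HodgeConjecture.HodgeConjecture.Cruxes.H413.K2E3GLnCongruenceIwahoriTriple

namespace Summit.HodgeConjecture.HodgeConjecture.Cruxes.H413.K2E3GLnCongruenceIwahoriOrders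

/-! ## §1  Generic: set-theoretic triple factorisations `↑K₀ = ↑(K₀ ⊓ A)·↑(K₀ ⊓ B)·↑(K₀ ⊓ C)` -/

section Generic

variable {G : Type*} [Group G] {K₀ A B C : Subgroup G}

/-- **A set-theoretic triple factorisation `↑K₀ = ↑(K₀ ⊓ V)·↑(K₀ ⊓ T)·↑(K₀ ⊓ U)` yields ★ (A)'s binder `hIw`** (unpacking `Set.mem_mul`; e.g. from the field
`.factorization j` of ★ `iwahoriDatumGL`, or from §2 below). [cite: Casselman1995, Prop. 1.4.4] -/
theorem forall_exists_mul_of_coe_eq_mul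
    (h : (K₀ : Set G) = ((K₀ ⊓ A : Subgroup G) : Set G) * ((K₀ ⊓ B : Subgroup G) : Set G) * ((K₀ ⊓ C : Subgroup G) : Set G)) :
    ∀ k ∈ K₀, ∃ a ∈ K₀ ⊓ A, ∃ b ∈ K₀ ⊓ B, ∃ c ∈ K₀ ⊓ C, k = a * b * c := by
  intro k hk
  have hk' : k ∈ ((K₀ ⊓ A : Subgroup G) : Set G) * ((K₀ ⊓ B : Subgroup G) : Set G) * ((K₀ ⊓ C : Subgroup G) : Set G) := by
    rw [← h]; exact hk
  obtain ⟨_, ⟨a, ha, b, hb, rfl⟩, c, hc, rfl⟩ := hk'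
  exact ⟨a, ha, b, hb, c, hc, rfl⟩

/-- The converse packing: the `hIw` binder gives the set-theoretic factorisation. [cite: Casselman1995, Prop. 1.4.4] -/
theorem coe_eq_mul_of_forall_exists_mul (h : ∀ k ∈ K₀, ∃ a ∈ K₀ ⊓ A, ∃ b ∈ K₀ ⊓ B, ∃ c ∈ K₀ ⊓ C, k = a * b * c) :
    (K₀ : Set G) = ((K₀ ⊓ A : Subgroup G) : Set G) * ((K₀ ⊓ B : Subgroup G) : Set G) * ((K₀ ⊓ C : Subgroup G) : Set G) := by
  apply le_antisymm
  · intro k hk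
    obtain ⟨a, ha, b, hb, c, hc, rfl⟩ := h k hk
    exact Set.mem_mul.2 ⟨a * b, Set.mem_mul.2 ⟨a, ha, b, hb, rfl⟩, c, hc, rfl⟩
  · rintro _ ⟨_, ⟨a, ha, b, hb, rfl⟩, d, hd, rfl⟩
    exact Subgroup.mul_mem _ (Subgroup.mul_mem _ ha.1 hb.1) hd.1

/-- **Conjugation**: if `w^{±1}` normalise `K₀`, a factorisation w.r.t. `(A, B, C)` gives one w.r.t. `(wAw⁻¹, wBw⁻¹, wCw⁻¹)` (★ FILE 1 `iwahori_map_conj` in set form).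
[cite: HarishChandra1970, Part VII §8 p. 81] -/
theorem coe_eq_mul_map_conj (w : G) (hw : ∀ k ∈ K₀, w * k * w⁻¹ ∈ K₀) (hw' : ∀ k ∈ K₀, w⁻¹ * k * w ∈ K₀)
    (h : (K₀ : Set G) = ((K₀ ⊓ A : Subgroup G) : Set G) * ((K₀ ⊓ B : Subgroup G) : Set G) * ((K₀ ⊓ C : Subgroup G) : Set G)) :
    (K₀ : Set G) = ((K₀ ⊓ A.map (MulAut.conj w).toMonoidHom : Subgroup G) : Set G) * ((K₀ ⊓ B.map (MulAut.conj w).toMonoidHom : Subgroup G) : Set G) *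
      ((K₀ ⊓ C.map (MulAut.conj w).toMonoidHom : Subgroup G) : Set G) :=
  coe_eq_mul_of_forall_exists_mul (iwahori_map_conj K₀ A B C w hw hw' (forall_exists_mul_of_coe_eq_mul h))

end Generic

/-! ## §2  `GL_n(F)`: every standard parabolic, every level `γ < 1` -/

section GLn

variable {F : Type*} [Field F] [ValuativeRel F] {n : ℕ} {α : Type*} [LinearOrder α] [Fintype α] (c : Fin n → α)

/-- **LEVI SPLITTING OF THE CONGRUENT STANDARD PARABOLIC**: for `γ < 1` and `p ∈ P_c ∩ K_γ`, the block-diagonal part `t` of `p` lies in `M_c ∩ K_γ` (★ `isUnit_det_and_valBound_inv`)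
and `u = t⁻¹ p ∈ U_c ∩ K_γ`; `p = t u`.  Any finite linear order of labels. [cite: Casselman1995, Prop. 1.4.4] [cite: HarishChandra1970, Part VII §8 p. 81] -/
theorem exists_levi_mul_radical_of_mem_congruenceGL {γ : ValueGroupWithZero F} (hγ : γ < 1) {p : GL (Fin n) F}
    (hp : p ∈ standardParabolicGL F c) (hpK : p ∈ congruenceGL n γ) :
    ∃ t ∈ standardLeviGL F c, ∃ u ∈ unipotentRadicalGL F c, t ∈ congruenceGL n γ ∧ u ∈ congruenceGL n γ ∧ p = t * u := by
  classical
  set T : Matrix (Fin n) (Fin n) F := Matrix.of fun i j => if c i = c j then (p : Matrix (Fin n) (Fin n) F) i j else 0 with hT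
  have hT1 : ValBound γ (T - 1) := by
    intro i j
    by_cases hij : c i = c j
    · have h := hpK.2.1 i j
      rw [Matrix.sub_apply] at h ⊢
      rw [hT, Matrix.of_apply, if_pos hij]
      exact h
    · have hne : i ≠ j := fun h => hij (congrArg c h)
      rw [Matrix.sub_apply, hT, Matrix.of_apply, if_neg hij, Matrix.one_apply_ne hne, sub_zero, map_zero]
      exact zero_le
  obtain ⟨hTunit, hTinv1, hTinvγ⟩ := isUnit_det_and_valBound_inv hT1 hγ
  set t : GL (Fin n) F := Matrix.GeneralLinearGroup.mkOfDetNeZero T hTunit.ne_zero with ht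
  have ht_coe : (t : Matrix (Fin n) (Fin n) F) = T := rfl
  have ht_inv : ((t⁻¹ : GL (Fin n) F) : Matrix (Fin n) (Fin n) F) = T⁻¹ := by
    rw [Matrix.coe_units_inv, ht_coe]
  have htK : t ∈ congruenceGL n γ := by
    refine ⟨⟨?_, ?_⟩, ?_, ?_⟩
    · rw [ht_coe]; exact hT1.of_sub_one hγ.le
    · rw [ht_inv]; exact hTinv1
    · rw [ht_coe]; exact hT1
    · rw [ht_inv]; exact hTinvγ
  have htM : t ∈ standardLeviGL F c := (mem_standardLeviGL_iff c t).2 fun i j hij => by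
    rw [ht_coe, hT, Matrix.of_apply, if_neg hij]
  have htinvM : ∀ i k : Fin n, c i ≠ c k → (T⁻¹) i k = 0 := fun i k hik => by
    rw [← ht_inv]; exact (mem_standardLeviGL_iff c _).1 (Subgroup.inv_mem _ htM) i k hik
  have hp0 : ∀ k j : Fin n, c j < c k → (p : Matrix (Fin n) (Fin n) F) k j = 0 := fun k j hkj => ((mem_standardParabolicGL_iff c p).1 hp) hkj
  refine ⟨t, htM, t⁻¹ * p, ?_, htK, Subgroup.mul_mem _ (Subgroup.inv_mem _ htK) hpK, (mul_inv_cancel_left t p).symm⟩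
  rw [mem_unipotentRadicalGL_iff_apply]
  intro i j hij
  rw [Units.val_mul, ht_inv, Matrix.mul_apply]
  rcases hij.lt_or_eq with hlt | heq
  · -- strictly below the block diagonal (`c j < c i`): every term vanishes
    rw [Matrix.one_apply_ne (fun h => hlt.ne (congrArg c h).symm)]
    refine Finset.sum_eq_zero fun k _ => ?_
    by_cases hik : c i = c k
    · rw [hp0 k j (lt_of_lt_of_eq hlt hik), mul_zero]
    · rw [htinvM i k hik, zero_mul]
  · -- on the block diagonal: the block of `T⁻¹ T = 1`
    have h1 : (T⁻¹ * T) i j = (1 : Matrix (Fin n) (Fin n) F) i j := by rw [Matrix.nonsing_inv_mul T hTunit]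
    rw [← h1, Matrix.mul_apply]
    refine Finset.sum_congr rfl fun k _ => ?_
    by_cases hik : c i = c k
    · rw [hT, Matrix.of_apply, if_pos (hik.symm.trans heq.symm)]
    · rw [htinvM i k hik, zero_mul, zero_mul]

/-- **`↑K_γ = ↑(K_γ ⊓ U_c) * ↑(K_γ ⊓ M_c) * ↑(K_γ ⊓ U_{c⁻})` FOR EVERY LABELLING `c : Fin n → α` AND EVERY `γ < 1`** (`u t v` order; Borel: `c = id`; all standard
parabolics; any label type): ★ `exists_parabolic_mul_lower_of_mem_congruenceGL` (`k = p v`), the Levi splitting `p = t u'`, and `t u' = (t u' t⁻¹) t` (★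
`conj_mem_unipotentRadicalGL_of_mem_standardLeviGL`).  Combine with §1 `forall_exists_mul_of_coe_eq_mul` for ★ (A)'s `hIw` with `(V, T, U) = (U_c, M_c, U_{c⁻})`.
[cite: Casselman1995, Prop. 1.4.4] [cite: BernsteinZelevinsky1976, §3.13] -/
theorem coe_congruenceGL_eq_mul_iwahori' {γ : ValueGroupWithZero F} (hγ : γ < 1) :
    (congruenceGL n γ : Set (GL (Fin n) F)) =
      ((congruenceGL n γ ⊓ unipotentRadicalGL F c : Subgroup (GL (Fin n) F)) : Set (GL (Fin n) F)) *
        ((congruenceGL n γ ⊓ standardLeviGL F c : Subgroup (GL (Fin n) F)) : Set (GL (Fin n) F)) *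
          ((congruenceGL n γ ⊓ unipotentRadicalGL F (OrderDual.toDual ∘ c) : Subgroup (GL (Fin n) F)) : Set (GL (Fin n) F)) := by
  refine coe_eq_mul_of_forall_exists_mul fun k hk => ?_
  obtain ⟨p, hpP, hpK, v, hvV, hvK, rfl⟩ := exists_parabolic_mul_lower_of_mem_congruenceGL c hγ hk
  obtain ⟨t, htM, u, huU, htK, huK, rfl⟩ := exists_levi_mul_radical_of_mem_congruenceGL c hγ hpP hpK
  refine ⟨t * u * t⁻¹, ⟨?_, conj_mem_unipotentRadicalGL_of_mem_standardLeviGL c htM huU⟩, t, ⟨htK, htM⟩, v, ⟨hvK, hvV⟩, by group⟩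
  exact Subgroup.mul_mem _ (Subgroup.mul_mem _ htK huK) (Subgroup.inv_mem _ htK)

/-- **`↑K_γ = ↑(K_γ ⊓ U_{c⁻}) * ↑(K_γ ⊓ M_c) * ↑(K_γ ⊓ U_c)`** (`v t u` order; every labelling, every `γ < 1`) — with §1 `forall_exists_mul_of_coe_eq_mul` this is ★ (A)'s `hIw` for
`(V, T, U) = (U_{c⁻}, M_c, U_c)`; ★ `iwahoriDatumGL….factorization j` is the case `γ = |ϖ|^{j+1}`, `Fin r`-labels. [cite: Casselman1995, Prop. 1.4.4] [cite: HarishChandra1970, Part VII §8 p. 81] -/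
theorem coe_congruenceGL_eq_mul_iwahori {γ : ValueGroupWithZero F} (hγ : γ < 1) :
    (congruenceGL n γ : Set (GL (Fin n) F)) =
      ((congruenceGL n γ ⊓ unipotentRadicalGL F (OrderDual.toDual ∘ c) : Subgroup (GL (Fin n) F)) : Set (GL (Fin n) F)) *
        ((congruenceGL n γ ⊓ standardLeviGL F c : Subgroup (GL (Fin n) F)) : Set (GL (Fin n) F)) *
          ((congruenceGL n γ ⊓ unipotentRadicalGL F c : Subgroup (GL (Fin n) F)) : Set (GL (Fin n) F)) :=
  F0P3cStCharTSShellKN.coe_eq_mul_mul_symm _ _ _ _ (coe_congruenceGL_eq_mul_iwahori' c hγ)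

/-- **The `GL_n(𝒪)`-conjugate triples** (e.g. `w = permGL σ`, ★ `permGL_mem_glInt`; the Weyl chambers of T20-GL₃): `↑K_γ = ↑(K_γ ⊓ wU_{c⁻}w⁻¹) * ↑(K_γ ⊓ wM_cw⁻¹) * ↑(K_γ ⊓ wU_cw⁻¹)`.
[cite: HarishChandra1970, Part VII §8 p. 81] [cite: Casselman1995, Prop. 1.4.4] -/
theorem coe_congruenceGL_eq_mul_iwahori_map_conj {γ : ValueGroupWithZero F} (hγ : γ < 1) {w : GL (Fin n) F} (hw : w ∈ glInt n F) :
    (congruenceGL n γ : Set (GL (Fin n) F)) =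
      ((congruenceGL n γ ⊓ (unipotentRadicalGL F (OrderDual.toDual ∘ c)).map (MulAut.conj w).toMonoidHom : Subgroup (GL (Fin n) F)) : Set (GL (Fin n) F)) *
        ((congruenceGL n γ ⊓ (standardLeviGL F c).map (MulAut.conj w).toMonoidHom : Subgroup (GL (Fin n) F)) : Set (GL (Fin n) F)) *
          ((congruenceGL n γ ⊓ (unipotentRadicalGL F c).map (MulAut.conj w).toMonoidHom : Subgroup (GL (Fin n) F)) : Set (GL (Fin n) F)) :=
  coe_eq_mul_map_conj w (fun _ hk => conj_mem_congruenceGL_of_mem_glInt hw hk)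
    (fun k hk => by
      have h := conj_mem_congruenceGL_of_mem_glInt (Subgroup.inv_mem _ hw) hk
      rwa [inv_inv] at h)
    (coe_congruenceGL_eq_mul_iwahori c hγ)

/-- **The `GL_n(𝒪)`-conjugate triples, `u t v` order**: `↑K_γ = ↑(K_γ ⊓ wU_cw⁻¹) * ↑(K_γ ⊓ wM_cw⁻¹) * ↑(K_γ ⊓ wU_{c⁻}w⁻¹)`. [cite: HarishChandra1970, Part VII §8 p. 81] -/
theorem coe_congruenceGL_eq_mul_iwahori_map_conj' {γ : ValueGroupWithZero F} (hγ : γ < 1) {w : GL (Fin n) F} (hw : w ∈ glInt n F) :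
    (congruenceGL n γ : Set (GL (Fin n) F)) =
      ((congruenceGL n γ ⊓ (unipotentRadicalGL F c).map (MulAut.conj w).toMonoidHom : Subgroup (GL (Fin n) F)) : Set (GL (Fin n) F)) *
        ((congruenceGL n γ ⊓ (standardLeviGL F c).map (MulAut.conj w).toMonoidHom : Subgroup (GL (Fin n) F)) : Set (GL (Fin n) F)) *
          ((congruenceGL n γ ⊓ (unipotentRadicalGL F (OrderDual.toDual ∘ c)).map (MulAut.conj w).toMonoidHom : Subgroup (GL (Fin n) F)) : Set (GL (Fin n) F)) :=
  coe_eq_mul_map_conj w (fun _ hk => conj_mem_congruenceGL_of_mem_glInt hw hk)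
    (fun k hk => by
      have h := conj_mem_congruenceGL_of_mem_glInt (Subgroup.inv_mem _ hw) hk
      rwa [inv_inv] at h)
    (coe_congruenceGL_eq_mul_iwahori' c hγ)

end GLn

end Summit.HodgeConjecture.HodgeConjecture.Cruxes.H413.K2E3GLnCongruenceIwahoriOrders
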